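import Literature.NumberTheory.LFunctions.RHInvZetaBound
import HarnessLib

/-!
# Littlewood's bounds `ζ(s)^{±1} = O(t^ε)` on `σ > 1/2` under RH (Titchmarsh Thm. 14.2)

Topic: `Literature/NumberTheory/LFunctions`. Consequences of Titchmarsh, *The Theory of the
Riemann Zeta-Function*, 2nd ed. (1986), Thm. 14.2, in the form of eqs. (14.2.5)–(14.2.6): on the
Riemann hypothesis, for every fixed `σ₀ > 1/2` and `ε > 0`,

  `ζ(σ + it) = O(|t|^ε)` and `1/ζ(σ + it) = O(|t|^ε)` uniformly in `σ ≥ σ₀`.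

The tree already proves (14.2.6) (`Literature.NumberTheory.LFunctions.InvZetaRH.norm_inv_riemannZeta_le_rpow`,
`RHInvZetaBound.lean`) from the Borel–Carathéodory bound (14.2.2) for a holomorphic branch `L` of
`log ζ` on discs centred `3 + it` (`Literature.NumberTheory.LFunctions.InvZetaRH.exists_log_riemannZeta`) and the three-circles
interpolation `‖L(σ+it)‖ ≤ B₂ (A₃ δ⁻¹ log|t|)^{a₀(δ)}`, `a₀ < 1`
(`Literature.NumberTheory.LFunctions.InvZetaRH.norm_log_le_rpow`). Since `‖ζ‖ = exp (Re L) ≤ exp ‖L‖` exactly as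
`‖ζ⁻¹‖ = exp (-Re L) ≤ exp ‖L‖`, the same two results give (14.2.5); this file records it, together
with the all-`t` forms of both bounds (with `(1 + |t|)^ε` and a constant, on closed half-planes and
strips avoiding the pole `s = 1`) that are used in mean-square estimates on vertical lines, and the
pole-free normalisation `(s - 1)/ζ₁(s)` of `1/ζ(s)` (`ζ₁ = riemannZeta₁`, Mathlib's entire
completion of `(s-1)ζ(s)`), which under RH is holomorphic on `Re s > 1/2`.

## Main results (all under `RiemannHypothesis`, all proved)

* `Literature.NumberTheory.LFunctions.LittlewoodRH.norm_riemannZeta_le_rpow` — (14.2.5): for `σ₀ > 1/2`, `ε > 0` there is `T > 0`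
  with `‖ζ(σ+it)‖ ≤ |t|^ε` for `σ ≥ σ₀`, `|t| ≥ T`.
* `Literature.NumberTheory.LFunctions.LittlewoodRH.norm_riemannZeta_le_of_RH` — `‖ζ(s)‖ ≤ C |Im s|^ε` for `Re s ≥ σ₀`,
  `|Im s| ≥ 1`; `norm_riemannZeta_le_of_RH'` — `‖ζ(s)‖ ≤ C (1+|Im s|)^ε` on `σ₀ ≤ Re s ≤ σ₁ < 1`.
* `Literature.NumberTheory.LFunctions.LittlewoodRH.norm_inv_riemannZeta_le_of_RH` — (14.2.6), all `t`: `‖ζ(s)⁻¹‖ ≤ C (1+|Im s|)^ε`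
  for `Re s ≥ σ₀`, `s ≠ 1`; `norm_sub_one_div_riemannZeta₁_le_of_RH` — the same for `(s-1)/ζ₁(s)`.

## References

* E. C. Titchmarsh, *The Theory of the Riemann Zeta-Function*, 2nd ed. revised by
  D. R. Heath-Brown, Oxford 1986, §14.2: Thm. 14.2 and eqs. (14.2.2), (14.2.5), (14.2.6).
* J. E. Littlewood, *Quelques conséquences de l'hypothèse que la fonction ζ(s) n'a pas de zéros
  dans le demi-plan Re(s) > 1/2*, C. R. Acad. Sci. Paris 154 (1912), 263–266.

The file has no definitions.
-/

noncomputable section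

open Complex Filter Topology Metric Set
open scoped Real

namespace Literature.NumberTheory.LFunctions

namespace LittlewoodRH

open InvZetaRH

/-! ### RH and the entire function `ζ₁` -/

/-- Under RH, Mathlib's entire function `ζ₁(s)` (`riemannZeta₁`, `= (s-1)ζ(s)` off `s = 1`,
`ζ₁(1) = 1`) has no zeros with `Re s > 1/2`. [folklore] -/
theorem riemannZeta₁_ne_zero_of_RH (hRH : RiemannHypothesis) {s : ℂ} (hs : 1 / 2 < s.re) :
    riemannZeta₁ s ≠ 0 := by
  rcases eq_or_ne s 1 with rfl | hs1
  · rw [riemannZeta₁_one]; exact one_ne_zero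
  have h := riemannZeta_eq_inv_sub_mul hs1
  intro h0
  rw [h0, mul_zero] at h
  exact riemannZeta_ne_zero_of_RH hRH hs h

/-- For `s ≠ 1`, `ζ(s)⁻¹ = (s - 1)/ζ₁(s)`. [folklore] -/
lemma inv_riemannZeta_eq (s : ℂ) (hs1 : s ≠ 1) :
    (riemannZeta s)⁻¹ = (s - 1) / riemannZeta₁ s := by
  rw [riemannZeta_eq_inv_sub_mul hs1, mul_inv, inv_inv, div_eq_mul_inv]

/-- Under RH the pole-free normalisation `s ↦ (s - 1)/ζ₁(s)` of `1/ζ` is holomorphic on the open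
half-plane `Re s > 1/2`. [folklore] -/
theorem differentiableOn_sub_one_div_riemannZeta₁ (hRH : RiemannHypothesis) :
    DifferentiableOn ℂ (fun s : ℂ ↦ (s - 1) / riemannZeta₁ s) {s : ℂ | 1 / 2 < s.re} :=
  DifferentiableOn.div (by fun_prop) differentiable_riemannZeta₁.differentiableOn
    fun _ hs ↦ riemannZeta₁_ne_zero_of_RH hRH hs

/-- Under RH, `s ↦ (s - 1)/ζ₁(s)` is continuous on the open half-plane `Re s > 1/2`. [folklore] -/
theorem continuousOn_sub_one_div_riemannZeta₁ (hRH : RiemannHypothesis) :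
    ContinuousOn (fun s : ℂ ↦ (s - 1) / riemannZeta₁ s) {s : ℂ | 1 / 2 < s.re} :=
  (differentiableOn_sub_one_div_riemannZeta₁ hRH).continuousOn

/-! ### Titchmarsh (14.2.5) -/

/-- **Littlewood 1912; Titchmarsh 1986, Thm. 14.2, eq. (14.2.5): under RH, `ζ(s) = O(t^ε)` for
every `σ > 1/2`**, uniformly in `σ ≥ σ₀ > 1/2`: for every `σ₀ > 1/2` and `ε > 0` there is `T > 0`
with `‖ζ(σ+it)‖ ≤ |t|^ε` for all `σ ≥ σ₀`, `|t| ≥ T`. Proof (Titchmarsh §14.2): with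
`δ = min((σ₀ − 1/2)/2, 1/2)`, (14.2.2) (`InvZetaRH.exists_log_riemannZeta`) and the three-circles
step (`InvZetaRH.norm_log_le_rpow`) give `log|ζ(σ+it)| = Re L ≤ ‖L(σ+it)‖ ≤ B₂ (A₃δ⁻¹ log|t|)^{a₀}
≤ ε log|t|` for `log|t|` large (as `a₀ < 1`) when `σ ≤ 5/2`; for `σ ≥ 5/2`, `‖ζ‖ ≤ 1 + ρ < 2`.
[cite: Titchmarsh1986, Thm 14.2, eq. (14.2.5)] -/
theorem norm_riemannZeta_le_rpow (hRH : RiemannHypothesis) {σ₀ : ℝ} (hσ₀ : 1 / 2 < σ₀)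
    {ε : ℝ} (hε : 0 < ε) :
    ∃ T : ℝ, 0 < T ∧ ∀ σ t : ℝ, σ₀ ≤ σ → T ≤ |t| → ‖riemannZeta (σ + t * I)‖ ≤ |t| ^ ε := by
  set δ : ℝ := min ((σ₀ - 1 / 2) / 2) (1 / 2) with hδdef
  have hδ : 0 < δ := lt_min (by linarith) (by norm_num)
  have hδ2 : δ ≤ 1 / 2 := min_le_right _ _
  have hσδ : 1 / 2 + 2 * δ ≤ σ₀ := by
    have := min_le_left ((σ₀ - 1 / 2) / 2) (1 / 2)
    rw [← hδdef] at this
    linarith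
  set K : ℝ := A₃ / δ with hK
  have hK40 : 40 ≤ K := forty_le_A₃_div hδ hδ2
  set a : ℝ := a₀ δ with ha
  have ha1 : a < 1 := a₀_lt_one hδ hδ2
  have ha0 : 0 ≤ a := a₀_nonneg hδ hδ2
  have hB₂ := one_le_B₂
  set Y : ℝ := (B₂ * K / ε) ^ (1 / (1 - a)) with hY
  have hY0 : 0 ≤ Y := Real.rpow_nonneg (by positivity) _
  have hρ := rho_lt_one
  have hρ0 := rho_pos
  set T : ℝ := max (max 7 (Real.exp Y)) ((2 : ℝ) ^ (1 / ε)) with hT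
  refine ⟨T, lt_of_lt_of_le (by norm_num) ((le_max_left _ _).trans (le_max_left _ _)),
    fun σ t hσ ht => ?_⟩
  have ht7 : 7 ≤ |t| := le_trans (le_max_left _ _) (le_trans (le_max_left _ _) ht)
  have htY : Real.exp Y ≤ |t| := le_trans (le_max_right _ _) (le_trans (le_max_left _ _) ht)
  have ht2 : (2 : ℝ) ^ (1 / ε) ≤ |t| := le_trans (le_max_right _ _) ht
  have htpos : 0 < |t| := by linarith
  have hlog1 : 1 ≤ Real.log |t| := one_le_log_abs ht7
  have hlogY : Y ≤ Real.log |t| := (Real.le_log_iff_exp_le htpos).mpr htY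
  by_cases hσ5 : σ ≤ 5 / 2
  · obtain ⟨L, hLd, hexp, hV, hM₃⟩ := exists_log_riemannZeta hRH hδ hδ2 ht7
    set z : ℂ := σ + t * I with hzdef
    have hzball : z ∈ ball (ctr t) (R₀ δ) := by
      have hzc : z - ctr t = ((σ - 3 : ℝ) : ℂ) := by
        simp only [hzdef, ctr]; push_cast; ring
      rw [mem_ball, dist_eq_norm, hzc, Complex.norm_real, Real.norm_eq_abs,
        abs_of_nonpos (by linarith)]
      unfold R₀; linarith
    have hLz : ‖L z‖ ≤ B₂ * (K * Real.log |t|) ^ a :=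
      norm_log_le_rpow hδ hδ2 ht7 hLd hV hM₃ (hσδ.trans hσ) hσ5
    have hK1 : 1 ≤ K := by linarith
    have hKa : (K * Real.log |t|) ^ a ≤ K * Real.log |t| ^ a := by
      rw [Real.mul_rpow (by linarith) (by linarith)]
      gcongr
      calc K ^ a ≤ K ^ (1 : ℝ) := Real.rpow_le_rpow_of_exponent_le hK1 ha1.le
        _ = K := Real.rpow_one K
    have hpow : B₂ * K / ε ≤ Real.log |t| ^ (1 - a) := by
      have h1 : Y ^ (1 - a) = B₂ * K / ε := by
        rw [hY, ← Real.rpow_mul (by positivity), one_div_mul_cancel (by linarith), Real.rpow_one]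
      rw [← h1]
      exact Real.rpow_le_rpow hY0 hlogY (by linarith)
    have hsplit : Real.log |t| = Real.log |t| ^ a * Real.log |t| ^ (1 - a) := by
      rw [← Real.rpow_add (by linarith)]; norm_num
    have hmain : B₂ * (K * Real.log |t| ^ a) ≤ ε * Real.log |t| := by
      have hla : 0 ≤ Real.log |t| ^ a := Real.rpow_nonneg (by linarith) _
      calc B₂ * (K * Real.log |t| ^ a) = (B₂ * K / ε) * ε * Real.log |t| ^ a := by
            field_simp
        _ ≤ Real.log |t| ^ (1 - a) * ε * Real.log |t| ^ a := by gcongr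
        _ = ε * (Real.log |t| ^ a * Real.log |t| ^ (1 - a)) := by ring
        _ = ε * Real.log |t| := by rw [← hsplit]
    have hLz' : ‖L z‖ ≤ ε * Real.log |t| := by
      calc ‖L z‖ ≤ B₂ * (K * Real.log |t|) ^ a := hLz
        _ ≤ B₂ * (K * Real.log |t| ^ a) := by gcongr
        _ ≤ ε * Real.log |t| := hmain
    -- `‖ζ(z)‖ = exp(Re L z) ≤ exp ‖L z‖ ≤ |t|^ε`
    rw [← hexp z hzball, norm_exp, Real.rpow_def_of_pos htpos]
    refine Real.exp_le_exp.mpr ?_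
    have : (L z).re ≤ ‖L z‖ := re_le_norm (L z)
    nlinarith
  · -- `σ > 5/2`: `‖ζ‖ ≤ 1 + ρ ≤ 2 ≤ |t|^ε`
    have hσ2 : 2 ≤ ((σ : ℂ) + t * I).re := by simp; linarith
    have h1 : ‖riemannZeta (σ + t * I)‖ ≤ 2 := by
      have h := norm_riemannZeta_sub_one_le hσ2
      have := norm_le_norm_add_norm_sub' (riemannZeta (σ + t * I)) 1
      have := norm_sub_rev (riemannZeta (σ + t * I)) 1
      simp only [norm_one] at *
      linarith
    refine h1.trans ?_
    calc (2 : ℝ) = ((2 : ℝ) ^ (1 / ε)) ^ ε := by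
          rw [← Real.rpow_mul (by norm_num), one_div_mul_cancel hε.ne', Real.rpow_one]
      _ ≤ |t| ^ ε := Real.rpow_le_rpow (Real.rpow_nonneg (by norm_num) _) ht2 hε.le

/-! ### Compact regions -/

/-- Under RH, `ζ(s)⁻¹` is bounded on every compact subset of `Re s > 1/2` (through the continuous
function `(s-1)/ζ₁(s)`, which equals `ζ(s)⁻¹` off `s = 1`). [folklore] -/
theorem norm_inv_riemannZeta_le_of_isCompact (hRH : RiemannHypothesis) {K : Set ℂ}
    (hK : IsCompact K) (hK' : ∀ s ∈ K, 1 / 2 < s.re) :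
    ∃ C : ℝ, 0 < C ∧ ∀ s ∈ K, ‖(s - 1) / riemannZeta₁ s‖ ≤ C := by
  have hcont : ContinuousOn (fun s : ℂ ↦ (s - 1) / riemannZeta₁ s) K :=
    (continuousOn_sub_one_div_riemannZeta₁ hRH).mono hK'
  obtain ⟨C, hC⟩ := hK.exists_bound_of_continuousOn hcont
  exact ⟨max C 1, by positivity, fun s hs ↦ (hC s hs).trans (le_max_left _ _)⟩

/-- `ζ` is bounded on every compact set avoiding `s = 1`. [folklore] -/
theorem norm_riemannZeta_le_of_isCompact {K : Set ℂ} (hK : IsCompact K) (hK' : ∀ s ∈ K, s ≠ 1) :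
    ∃ C : ℝ, 0 < C ∧ ∀ s ∈ K, ‖riemannZeta s‖ ≤ C := by
  have hcont : ContinuousOn riemannZeta K := fun s hs ↦
    (differentiableAt_riemannZeta (hK' s hs)).continuousAt.continuousWithinAt
  obtain ⟨C, hC⟩ := hK.exists_bound_of_continuousOn hcont
  exact ⟨max C 1, by positivity, fun s hs ↦ (hC s hs).trans (le_max_left _ _)⟩

/-- The closed rectangle `[a,b] × [c,d]` is compact. [folklore] -/
lemma isCompact_rect (a b c d : ℝ) : IsCompact (Icc a b ×ℂ Icc c d) :=
  isCompact_Icc.reProdIm isCompact_Icc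

/-! ### The exported all-`t` bounds -/

/-- **Titchmarsh (14.2.6), all `t`, pole-free form.** Assume RH and let `σ₀ > 1/2`, `ε > 0`. Then
there is `C > 0` with `‖(s-1)/ζ₁(s)‖ ≤ C (1 + |Im s|)^ε` for all `s` with `Re s ≥ σ₀`
(`(s-1)/ζ₁(s) = ζ(s)⁻¹` for `s ≠ 1`). Proof: `InvZetaRH.norm_inv_riemannZeta_le_rpow` for
`|Im s| ≥ T`, `‖ζ⁻¹‖ ≤ (1-ρ)⁻¹` for `Re s ≥ 2`, continuity on the compact rectangle
`[σ₀, 2] × [-T, T]`. [cite: Titchmarsh1986, Thm 14.2, eq. (14.2.6)] -/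
theorem norm_sub_one_div_riemannZeta₁_le_of_RH (hRH : RiemannHypothesis) {σ₀ : ℝ}
    (hσ₀ : 1 / 2 < σ₀) {ε : ℝ} (hε : 0 < ε) :
    ∃ C : ℝ, 0 < C ∧ ∀ s : ℂ, σ₀ ≤ s.re →
      ‖(s - 1) / riemannZeta₁ s‖ ≤ C * (1 + |s.im|) ^ ε := by
  obtain ⟨T₀, hT₀⟩ := norm_inv_riemannZeta_le_rpow hRH hσ₀ hε
  set T : ℝ := max T₀ 1 with hT
  have hT1 : 1 ≤ T := le_max_right _ _
  obtain ⟨C₂, hC₂, hcpt⟩ := norm_inv_riemannZeta_le_of_isCompact hRH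
    (isCompact_rect σ₀ 2 (-T) T) (fun s hs ↦ lt_of_lt_of_le hσ₀ hs.1.1)
  have hρ := rho_lt_one
  refine ⟨1 + (1 - rho)⁻¹ + C₂, by positivity, fun s hs ↦ ?_⟩
  have hpow : 1 ≤ (1 + |s.im|) ^ ε := Real.one_le_rpow (by linarith [abs_nonneg s.im]) hε.le
  have hpow' : |s.im| ^ ε ≤ (1 + |s.im|) ^ ε :=
    Real.rpow_le_rpow (abs_nonneg _) (by linarith) hε.le
  have hiρ : 0 < (1 - rho)⁻¹ := inv_pos.mpr (by linarith)
  rcases le_or_gt T |s.im| with hlarge | hsmall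
  · -- `|t| ≥ T`: Littlewood
    have hs1 : s ≠ 1 := by
      intro h; rw [h] at hlarge; simp at hlarge; linarith
    have h := hT₀ s.re s.im hs ((le_max_left _ _).trans hlarge)
    rw [re_add_im] at h
    rw [← inv_riemannZeta_eq s hs1]
    calc ‖(riemannZeta s)⁻¹‖ ≤ |s.im| ^ ε := h
      _ ≤ 1 * (1 + |s.im|) ^ ε := by rw [one_mul]; exact hpow'
      _ ≤ (1 + (1 - rho)⁻¹ + C₂) * (1 + |s.im|) ^ ε := by gcongr; linarith
  rcases le_or_gt 2 s.re with hbig | hsmall'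
  · -- `Re s ≥ 2`
    have hs1 : s ≠ 1 := by
      intro h; rw [h] at hbig; norm_num at hbig
    rw [← inv_riemannZeta_eq s hs1]
    calc ‖(riemannZeta s)⁻¹‖ ≤ (1 - rho)⁻¹ := norm_inv_riemannZeta_le_of_two_le hbig
      _ ≤ (1 + (1 - rho)⁻¹ + C₂) * 1 := by nlinarith
      _ ≤ (1 + (1 - rho)⁻¹ + C₂) * (1 + |s.im|) ^ ε := by gcongr
  · -- compact part
    have hmem : s ∈ Icc σ₀ 2 ×ℂ Icc (-T) T :=
      ⟨⟨hs, hsmall'.le⟩, ⟨by linarith [neg_abs_le s.im], by linarith [le_abs_self s.im]⟩⟩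
    calc ‖(s - 1) / riemannZeta₁ s‖ ≤ C₂ := hcpt s hmem
      _ ≤ (1 + (1 - rho)⁻¹ + C₂) * 1 := by nlinarith
      _ ≤ (1 + (1 - rho)⁻¹ + C₂) * (1 + |s.im|) ^ ε := by gcongr

/-- **Titchmarsh (14.2.6): `1/ζ(s) = O(t^ε)` under RH**, all `t`. Assume RH and let
`σ₀ > 1/2`, `ε > 0`. Then there is `C > 0` with `‖ζ(s)⁻¹‖ ≤ C (1 + |Im s|)^ε` for all `s ≠ 1` with
`Re s ≥ σ₀`. [cite: Titchmarsh1986, Thm 14.2, eq. (14.2.6)] -/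
theorem norm_inv_riemannZeta_le_of_RH (hRH : RiemannHypothesis) {σ₀ : ℝ} (hσ₀ : 1 / 2 < σ₀)
    {ε : ℝ} (hε : 0 < ε) :
    ∃ C : ℝ, 0 < C ∧ ∀ s : ℂ, σ₀ ≤ s.re → s ≠ 1 →
      ‖(riemannZeta s)⁻¹‖ ≤ C * (1 + |s.im|) ^ ε := by
  obtain ⟨C, hC, h⟩ := norm_sub_one_div_riemannZeta₁_le_of_RH hRH hσ₀ hε
  exact ⟨C, hC, fun s hs hs1 ↦ by rw [inv_riemannZeta_eq s hs1]; exact h s hs⟩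

/-- **Titchmarsh (14.2.5): `ζ(s) = O(t^ε)` under RH**, with a constant. Assume RH and let
`σ₀ > 1/2`, `ε > 0`. Then there is `C > 0` with `‖ζ(s)‖ ≤ C |Im s|^ε` for `Re s ≥ σ₀`,
`|Im s| ≥ 1`. [cite: Titchmarsh1986, Thm 14.2, eq. (14.2.5)] -/
theorem norm_riemannZeta_le_of_RH (hRH : RiemannHypothesis) {σ₀ : ℝ} (hσ₀ : 1 / 2 < σ₀)
    {ε : ℝ} (hε : 0 < ε) :
    ∃ C : ℝ, 0 < C ∧ ∀ s : ℂ, σ₀ ≤ s.re → 1 ≤ |s.im| → ‖riemannZeta s‖ ≤ C * |s.im| ^ ε := by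
  obtain ⟨T₀, hT₀pos, hT₀⟩ := norm_riemannZeta_le_rpow hRH hσ₀ hε
  set T : ℝ := max T₀ 1 with hT
  have hne : ∀ s ∈ Icc σ₀ 2 ×ℂ Icc (1 : ℝ) T ∪ Icc σ₀ 2 ×ℂ Icc (-T) (-1), s ≠ 1 := by
    rintro s (hs | hs) h <;> rw [h] at hs
    · have := hs.2.1; simp at this; linarith
    · have := hs.2.2; simp at this; linarith
  obtain ⟨C₂, hC₂, hcpt⟩ := norm_riemannZeta_le_of_isCompact
    ((isCompact_rect σ₀ 2 1 T).union (isCompact_rect σ₀ 2 (-T) (-1))) hne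
  have hρ := rho_lt_one
  refine ⟨1 + 2 + C₂, by positivity, fun s hs ht ↦ ?_⟩
  have hpow : 1 ≤ |s.im| ^ ε := Real.one_le_rpow ht hε.le
  rcases le_or_gt T |s.im| with hlarge | hsmall
  · have h := hT₀ s.re s.im hs ((le_max_left _ _).trans hlarge)
    rw [re_add_im] at h
    calc ‖riemannZeta s‖ ≤ |s.im| ^ ε := h
      _ = 1 * |s.im| ^ ε := (one_mul _).symm
      _ ≤ (1 + 2 + C₂) * |s.im| ^ ε := by gcongr; linarith
  rcases le_or_gt 2 s.re with hbig | hsmall'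
  · have h1 : ‖riemannZeta s‖ ≤ 2 := by
      have h := norm_riemannZeta_sub_one_le hbig
      have := norm_le_norm_add_norm_sub' (riemannZeta s) 1
      have := norm_sub_rev (riemannZeta s) 1
      simp only [norm_one] at *
      linarith
    calc ‖riemannZeta s‖ ≤ 2 := h1
      _ ≤ (1 + 2 + C₂) * 1 := by nlinarith
      _ ≤ (1 + 2 + C₂) * |s.im| ^ ε := by gcongr
  · have hmem : s ∈ Icc σ₀ 2 ×ℂ Icc (1 : ℝ) T ∪ Icc σ₀ 2 ×ℂ Icc (-T) (-1) := by
      rcases le_or_gt 0 s.im with him | him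
      · left
        rw [abs_of_nonneg him] at ht hsmall
        exact ⟨⟨hs, hsmall'.le⟩, ⟨ht, hsmall.le⟩⟩
      · right
        rw [abs_of_neg him] at ht hsmall
        exact ⟨⟨hs, hsmall'.le⟩, ⟨by linarith, by linarith⟩⟩
    calc ‖riemannZeta s‖ ≤ C₂ := hcpt s hmem
      _ ≤ (1 + 2 + C₂) * 1 := by nlinarith
      _ ≤ (1 + 2 + C₂) * |s.im| ^ ε := by gcongr

/-- **`ζ(s) = O(t^ε)` under RH on closed strips left of the pole:** for `1/2 < σ₀`, `σ₁ < 1` and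
`ε > 0` there is `C > 0` with `‖ζ(s)‖ ≤ C (1+|Im s|)^ε` whenever `σ₀ ≤ Re s ≤ σ₁` (all `Im s`).
[cite: Titchmarsh1986, Thm 14.2, eq. (14.2.5)] -/
theorem norm_riemannZeta_le_of_RH' (hRH : RiemannHypothesis) {σ₀ σ₁ : ℝ} (hσ₀ : 1 / 2 < σ₀)
    (hσ₁ : σ₁ < 1) {ε : ℝ} (hε : 0 < ε) :
    ∃ C : ℝ, 0 < C ∧ ∀ s : ℂ, σ₀ ≤ s.re → s.re ≤ σ₁ →
      ‖riemannZeta s‖ ≤ C * (1 + |s.im|) ^ ε := by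
  obtain ⟨C₁, hC₁, h₁⟩ := norm_riemannZeta_le_of_RH hRH hσ₀ hε
  have hne : ∀ s ∈ Icc σ₀ σ₁ ×ℂ Icc (-1 : ℝ) 1, s ≠ 1 := by
    rintro s hs h
    rw [h] at hs
    have := hs.1.2; simp at this; linarith
  obtain ⟨C₂, hC₂, h₂⟩ := norm_riemannZeta_le_of_isCompact (isCompact_rect σ₀ σ₁ (-1) 1) hne
  refine ⟨C₁ + C₂, by positivity, fun s hs hs' ↦ ?_⟩
  have hpow : 1 ≤ (1 + |s.im|) ^ ε := Real.one_le_rpow (by linarith [abs_nonneg s.im]) hε.le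
  have hpow' : |s.im| ^ ε ≤ (1 + |s.im|) ^ ε :=
    Real.rpow_le_rpow (abs_nonneg _) (by linarith) hε.le
  rcases le_or_gt 1 |s.im| with ht | ht
  · calc ‖riemannZeta s‖ ≤ C₁ * |s.im| ^ ε := h₁ s hs ht
      _ ≤ C₁ * (1 + |s.im|) ^ ε := by gcongr
      _ ≤ (C₁ + C₂) * (1 + |s.im|) ^ ε := by gcongr; linarith
  · have hmem : s ∈ Icc σ₀ σ₁ ×ℂ Icc (-1 : ℝ) 1 :=
      ⟨⟨hs, hs'⟩, ⟨by linarith [neg_abs_le s.im], by linarith [le_abs_self s.im]⟩⟩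
    calc ‖riemannZeta s‖ ≤ C₂ := h₂ s hmem
      _ ≤ (C₁ + C₂) * 1 := by nlinarith
      _ ≤ (C₁ + C₂) * (1 + |s.im|) ^ ε := by gcongr

/-- **`ζ(s) = O(t^ε)` under RH on a vertical line `Re s = σ`, `1/2 < σ`, `σ ≠ 1`... in the form used
for mean squares: for `1/2 < σ < 1` and `ε > 0` there is `C > 0` with
`‖ζ(σ + it)‖ ≤ C (1 + |t|)^ε` for all real `t`. [cite: Titchmarsh1986, Thm 14.2, eq. (14.2.5)] -/
theorem norm_riemannZeta_line_le_of_RH (hRH : RiemannHypothesis) {σ : ℝ} (hσ : 1 / 2 < σ)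
    (hσ1 : σ < 1) {ε : ℝ} (hε : 0 < ε) :
    ∃ C : ℝ, 0 < C ∧ ∀ t : ℝ, ‖riemannZeta (σ + t * I)‖ ≤ C * (1 + |t|) ^ ε := by
  obtain ⟨C, hC, h⟩ := norm_riemannZeta_le_of_RH' hRH hσ hσ1 hε
  refine ⟨C, hC, fun t ↦ ?_⟩
  have := h (σ + t * I) (by simp) (by simp)
  simpa using this

/-- **`1/ζ(s) = O(t^ε)` under RH on a vertical line**, pole-free form: for `1/2 < σ` and `ε > 0`
there is `C > 0` with `‖(s-1)/ζ₁(s)‖ ≤ C (1 + |t|)^ε` at `s = σ + it`, all real `t`.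
[cite: Titchmarsh1986, Thm 14.2, eq. (14.2.6)] -/
theorem norm_sub_one_div_riemannZeta₁_line_le_of_RH (hRH : RiemannHypothesis) {σ : ℝ}
    (hσ : 1 / 2 < σ) {ε : ℝ} (hε : 0 < ε) :
    ∃ C : ℝ, 0 < C ∧ ∀ t : ℝ,
      ‖((σ : ℂ) + t * I - 1) / riemannZeta₁ (σ + t * I)‖ ≤ C * (1 + |t|) ^ ε := by
  obtain ⟨C, hC, h⟩ := norm_sub_one_div_riemannZeta₁_le_of_RH hRH hσ hε
  refine ⟨C, hC, fun t ↦ ?_⟩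
  have := h (σ + t * I) (by simp)
  simpa using this

end LittlewoodRH

end Literature.NumberTheory.LFunctions

end
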